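import Summits.Parity.GeneralizedHardyLittlewood.Theorems.PrimeLevelFamEdgeMomentsBeyondDiagonalDictionaryAtOneOffBoxWeight
import HarnessLib

/-!
# Route `PrimeLevelFamEdge`, crux K_A `MomentsBeyondDiagonal` (stmt-Parity-20007), line «petersson_layers» v4:
# THE IDENTIFICATION AT `Q = 1`, part B — the OFF-BOX error and the conclusion `‖TAIL(ρ) + FAR(ρ)‖ ≤ C_P q̂ (log q̂)⁻³`
# (lead prover, 2026-08-28; helper — the `Q = 1` slice of the registered stub `stub_identP : TailNearFar rhoP`)

* §2 `norm_offBoxTsum_le`: the pairs `(n₁,n₂)` outside the AFE box `nᵢ ≤ q²` contribute `≤ A'_P` to the exact dictionary series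
  (there `n₁n₂ ≥ q²`, so `W(n₁n₂/q̂²) ≤ 2·6!·2⁶ e^{−π√q} (q̂²/n₁n₂)³`, and `e^{−π√q} ≤ 12!/(π√q)^{12}`).
* §3 `tailNearFar_atOne`: for `q` prime `≥ 64`, `Δ' ∈ (1, 3/2]`, any cut with `ρ(Δ') ≤ 8`, any real polynomial `P`:
  `‖tail q ρ P 1 Δ' − (−farLayers q ρ P 1 Δ')‖ ≤ 27(2A_P + A'_P) · q̂ · (log q̂)⁻³` — the `Near` clause of `TailNearFar ρ` at
  `Q = 1` with a constant uniform in `Δ'`. With `…DictionaryAtOne` this closes, at `Q = 1`, the identification the line's docstrings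
  asserted («AFE ∘ Hecke ∘ Petersson + Weil for the truncations»). The `Q ≠ 1` slices wait on `kmv2000_eq22` at orders `k ≥ 1`.
Nothing here is a moment ASYMPTOTIC or a statement about `stub_core` / K_A (open, famE-02); no exceptional-zero claim (no GRH, no
Landau–Siegel).
-/

noncomputable section

open scoped MatrixGroups Real Nat
open CongruenceSubgroup Complex Finset Polynomial MeasureTheory
open Literature.NumberTheory.EllipticCurves.ModularForms
open Literature.NumberTheory.LFunctions

namespace Summit.Parity.GeneralizedHardyLittlewood.Theorems.PrimeLevelFamEdgeIdeaDeltas.PeterssonLayers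

/-! ## §2. The off-box error -/

/-- **§2. The off-box error is bounded.** For `q` prime `≥ 64` and `0 < Δ' ≤ 3/2`, the pairs outside the AFE box contribute at most
a constant `A'_P` to the exact dictionary series of `Q^h(P,1)(q̂^{Δ'})`. -/
theorem norm_offBoxTsum_le (P : ℝ[X]) :
    ∃ A' : ℝ, 0 ≤ A' ∧ ∀ (q : ℕ) [NeZero q], q.Prime → 64 ≤ q → ∀ Δ' : ℝ, 0 < Δ' → Δ' ≤ 3 / 2 →
      ‖∑' x : {n : ℕ × ℕ // n ∉ afeBox q ×ˢ afeBox q},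
          (2 * (KMV2000.qhat q : ℂ) *
            (((((x.1.1 : ℝ) * x.1.2) ^ (-(1 / 2 : ℝ)) : ℝ) : ℂ) *
              ((KMV2000.cutoffW ((x.1.1 : ℝ) * x.1.2 / KMV2000.qhat q ^ 2) : ℝ) : ℂ) *
            ∑ m₁ ∈ Icc 1 ⌊KMV2000.qhat q ^ Δ'⌋₊, ∑ m₂ ∈ Icc 1 ⌊KMV2000.qhat q ^ Δ'⌋₊,
              (KMV2000.mollifierCoeff P (KMV2000.qhat q ^ Δ') m₁ : ℂ) *
                (KMV2000.mollifierCoeff P (KMV2000.qhat q ^ Δ') m₂ : ℂ) *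
              ∑ d₁ ∈ (Nat.gcd m₁ x.1.1).divisors, ∑ d₂ ∈ (Nat.gcd m₂ x.1.2).divisors,
                KowalskiMichel2000.pet q (m₁ * x.1.1 / d₁ ^ 2) (m₂ * x.1.2 / d₂ ^ 2)))‖ ≤ A' := by
  obtain ⟨K, hK0, hK⟩ := exists_norm_pet_le
  obtain ⟨C, hC1, hC⟩ :=
    Literature.NumberTheory.Sieve.exists_card_divisors_le_mul_rpow' (by norm_num : (0 : ℝ) < 1 / 20)
  have hC0 : 0 ≤ C := zero_le_one.trans hC1
  set B : ℝ := ∑ i ∈ range (P.natDegree + 1), |P.coeff i| with hBdef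
  have hB : ∀ t ∈ Set.Icc (0 : ℝ) 1, |P.eval t| ≤ B := fun t ht ↦ abs_eval_le_sum_abs_coeff P ht
  have hZ4s : Summable (fun n : ℕ × ℕ ↦ ((n.1 : ℝ)) ^ (-(5 / 2 : ℝ)) * ((n.2 : ℝ)) ^ (-(5 / 2 : ℝ))) :=
    summable_prod_rpow (by norm_num)
  set Z₄ : ℝ := ∑' n : ℕ × ℕ, ((n.1 : ℝ)) ^ (-(5 / 2 : ℝ)) * ((n.2 : ℝ)) ^ (-(5 / 2 : ℝ)) with hZ₄
  have hZ₄0 : 0 ≤ Z₄ := tsum_nonneg fun n ↦ mul_nonneg (Real.rpow_nonneg (Nat.cast_nonneg _) _)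
    (Real.rpow_nonneg (Nat.cast_nonneg _) _)
  refine ⟨2 * ((1 + K) * B ^ 2 * C ^ 2) * (92160 * (12 ! : ℝ)) * Z₄, by positivity,
    fun q _ hq h64 Δ' h0 h32 ↦ ?_⟩
  obtain ⟨hM1, hM32, hMq⟩ := mollifierLength_facts h64 h0 h32
  have hqh1 : 1 < KMV2000.qhat q := one_lt_qhat h64
  have hqh0 : 0 < KMV2000.qhat q := zero_lt_one.trans hqh1
  have hq0 : (0 : ℝ) < q := by exact_mod_cast hq.pos
  set M : ℝ := KMV2000.qhat q ^ Δ' with hMdef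
  set S : ℝ := ∑ m ∈ Icc 1 ⌊M⌋₊, ((m : ℝ)) ^ (1 - 1 / 2 + 1 / 20 : ℝ) with hSdef
  have hS0 : 0 ≤ S := Finset.sum_nonneg fun m _ ↦ Real.rpow_nonneg (Nat.cast_nonneg _) _
  have hSle : S ≤ M ^ (31 / 20 : ℝ) := by
    have h := sum_Icc_rpow_le (M := M) (e := 11 / 20) hM1.le (by norm_num)
    have e1 : (1 - 1 / 2 + 1 / 20 : ℝ) = 11 / 20 := by norm_num
    have e2 : (11 / 20 + 1 : ℝ) = 31 / 20 := by norm_num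
    rw [hSdef, e1]; rw [e2] at h; exact h
  -- the majorant constant `D` and its size
  set D : ℝ := 2 * KMV2000.qhat q * ((1 + K) * B ^ 2 * C ^ 2 * S ^ 2) *
    (92160 * (12 ! : ℝ) * KMV2000.qhat q ^ (6 : ℝ) * ((q : ℝ)) ^ (-(6 : ℝ))) with hDdef
  have hD0 : 0 ≤ D := by positivity
  have hDle : D ≤ 2 * ((1 + K) * B ^ 2 * C ^ 2) * (92160 * (12 ! : ℝ)) := by
    have hS2 : S ^ 2 ≤ KMV2000.qhat q ^ (93 / 20 : ℝ) := by
      calc S ^ 2 ≤ (M ^ (31 / 20 : ℝ)) ^ 2 := by gcongr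
        _ = KMV2000.qhat q ^ (Δ' * (31 / 10) : ℝ) := by
            rw [hMdef, ← Real.rpow_natCast, ← Real.rpow_mul (Real.rpow_nonneg hqh0.le _),
              ← Real.rpow_mul hqh0.le]; norm_num
        _ ≤ KMV2000.qhat q ^ (93 / 20 : ℝ) := Real.rpow_le_rpow_of_exponent_le hqh1.le (by nlinarith)
    have hq6 : ((q : ℝ)) ^ (-(6 : ℝ)) ≤ KMV2000.qhat q ^ (-(12 : ℝ)) := by
      have h := level_rpow_neg_le (q := q) (s := 6) (by norm_num)
      rw [show (2 * (6 : ℝ)) = 12 by norm_num] at h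
      exact h
    have hpow : KMV2000.qhat q * S ^ 2 * (KMV2000.qhat q ^ (6 : ℝ) * ((q : ℝ)) ^ (-(6 : ℝ))) ≤ 1 := by
      calc KMV2000.qhat q * S ^ 2 * (KMV2000.qhat q ^ (6 : ℝ) * ((q : ℝ)) ^ (-(6 : ℝ)))
          ≤ KMV2000.qhat q ^ (1 : ℝ) * KMV2000.qhat q ^ (93 / 20 : ℝ) *
              (KMV2000.qhat q ^ (6 : ℝ) * KMV2000.qhat q ^ (-(12 : ℝ))) := by
            rw [Real.rpow_one]; gcongr
        _ = KMV2000.qhat q ^ (-(7 / 20 : ℝ)) := by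
            rw [← Real.rpow_add hqh0, ← Real.rpow_add hqh0, ← Real.rpow_add hqh0]; norm_num
        _ ≤ KMV2000.qhat q ^ (0 : ℝ) := Real.rpow_le_rpow_of_exponent_le hqh1.le (by norm_num)
        _ = 1 := Real.rpow_zero _
    calc D = (2 * ((1 + K) * B ^ 2 * C ^ 2) * (92160 * (12 ! : ℝ))) *
          (KMV2000.qhat q * S ^ 2 * (KMV2000.qhat q ^ (6 : ℝ) * ((q : ℝ)) ^ (-(6 : ℝ)))) := by rw [hDdef]; ring
      _ ≤ (2 * ((1 + K) * B ^ 2 * C ^ 2) * (92160 * (12 ! : ℝ))) * 1 := by gcongr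
      _ = _ := mul_one _
  -- the majorant and the pointwise bound off the box
  set g : ℕ × ℕ → ℝ := fun n ↦ D * (((n.1 : ℝ)) ^ (-(5 / 2 : ℝ)) * ((n.2 : ℝ)) ^ (-(5 / 2 : ℝ))) with hgdef
  have hg0 : ∀ n, 0 ≤ g n := fun n ↦ mul_nonneg hD0 (mul_nonneg (Real.rpow_nonneg (Nat.cast_nonneg _) _)
    (Real.rpow_nonneg (Nat.cast_nonneg _) _))
  have hgs : Summable g := hZ4s.mul_left D
  set F : ℕ × ℕ → ℂ := fun n ↦ 2 * (KMV2000.qhat q : ℂ) *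
      (((((n.1 : ℝ) * n.2) ^ (-(1 / 2 : ℝ)) : ℝ) : ℂ) *
        ((KMV2000.cutoffW ((n.1 : ℝ) * n.2 / KMV2000.qhat q ^ 2) : ℝ) : ℂ) *
      ∑ m₁ ∈ Icc 1 ⌊M⌋₊, ∑ m₂ ∈ Icc 1 ⌊M⌋₊,
        (KMV2000.mollifierCoeff P M m₁ : ℂ) * (KMV2000.mollifierCoeff P M m₂ : ℂ) *
        ∑ d₁ ∈ (Nat.gcd m₁ n.1).divisors, ∑ d₂ ∈ (Nat.gcd m₂ n.2).divisors,
          KowalskiMichel2000.pet q (m₁ * n.1 / d₁ ^ 2) (m₂ * n.2 / d₂ ^ 2)) with hFdef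
  have hpt : ∀ n : ℕ × ℕ, n ∉ afeBox q ×ˢ afeBox q → ‖F n‖ ≤ g n := by
    intro n hn
    by_cases h0 : n.1 = 0 ∨ n.2 = 0
    · have hr : (((n.1 : ℝ) * n.2) ^ (-(1 / 2 : ℝ)) : ℝ) = 0 := by
        have hz : ((n.1 : ℝ) * n.2) = 0 := by rcases h0 with h | h <;> simp [h]
        rw [hz, Real.zero_rpow (by norm_num)]
      have hF0 : F n = 0 := by rw [hFdef]; simp only; rw [hr]; simp
      rw [hF0, norm_zero]; exact hg0 n
    rw [not_or] at h0
    have h₁ : 1 ≤ n.1 := Nat.one_le_iff_ne_zero.mpr h0.1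
    have h₂ : 1 ≤ n.2 := Nat.one_le_iff_ne_zero.mpr h0.2
    -- off the box: `q² ≤ n₁ n₂`
    have hout : ((q : ℝ)) ^ 2 ≤ (n.1 : ℝ) * n.2 := by
      have hn' : ¬ (n.1 ≤ q ^ 2 ∧ n.2 ≤ q ^ 2) := by
        intro hh
        exact hn (Finset.mem_product.mpr ⟨by rw [afeBox, Finset.mem_Icc]; exact ⟨h₁, hh.1⟩,
          by rw [afeBox, Finset.mem_Icc]; exact ⟨h₂, hh.2⟩⟩)
      have hnat : q ^ 2 ≤ n.1 * n.2 := by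
        rcases not_and_or.mp hn' with h | h
        · exact le_trans (by omega) (Nat.le_mul_of_pos_right _ (by omega))
        · exact le_trans (by omega) (Nat.le_mul_of_pos_left _ (by omega))
      exact_mod_cast hnat
    -- the inner pair sum
    have hinner : ‖∑ m₁ ∈ Icc 1 ⌊M⌋₊, ∑ m₂ ∈ Icc 1 ⌊M⌋₊,
        (KMV2000.mollifierCoeff P M m₁ : ℂ) * (KMV2000.mollifierCoeff P M m₂ : ℂ) *
        ∑ d₁ ∈ (Nat.gcd m₁ n.1).divisors, ∑ d₂ ∈ (Nat.gcd m₂ n.2).divisors,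
          KowalskiMichel2000.pet q (m₁ * n.1 / d₁ ^ 2) (m₂ * n.2 / d₂ ^ 2)‖ ≤
        (1 + K) * B ^ 2 * C ^ 2 * (((n.1 : ℝ) * n.2) ^ (1 : ℝ)) * S ^ 2 := by
      have hG : ∀ m₁ ∈ Icc 1 ⌊M⌋₊, ∀ m₂ ∈ Icc 1 ⌊M⌋₊, ∀ d₁ ∈ (Nat.gcd m₁ n.1).divisors,
          ∀ d₂ ∈ (Nat.gcd m₂ n.2).divisors,
          ‖(fun a b ↦ KowalskiMichel2000.pet q a b) (m₁ * n.1 / d₁ ^ 2) (m₂ * n.2 / d₂ ^ 2)‖ ≤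
            (1 + K) * ((((m₁ * n.1 / d₁ ^ 2 : ℕ) : ℝ)) * ((m₂ * n.2 / d₂ ^ 2 : ℕ) : ℝ)) ^ (1 : ℝ) := by
        intro m₁ hm₁ m₂ hm₂ d₁ hd₁ d₂ hd₂
        have ha : 1 ≤ m₁ * n.1 / d₁ ^ 2 := one_le_mul_div_sq hd₁ (Finset.mem_Icc.mp hm₁).1 h₁
        have hb : 1 ≤ m₂ * n.2 / d₂ ^ 2 := one_le_mul_div_sq hd₂ (Finset.mem_Icc.mp hm₂).1 h₂
        have h := hK q hq _ _ ha hb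
        simp only [Real.rpow_one]
        calc ‖KowalskiMichel2000.pet q (m₁ * n.1 / d₁ ^ 2) (m₂ * n.2 / d₂ ^ 2)‖
            ≤ (1 + K) * ((m₁ * n.1 / d₁ ^ 2 : ℕ) : ℝ) * ((m₂ * n.2 / d₂ ^ 2 : ℕ) : ℝ) := h
          _ = (1 + K) * (((m₁ * n.1 / d₁ ^ 2 : ℕ) : ℝ) * ((m₂ * n.2 / d₂ ^ 2 : ℕ) : ℝ)) := by ring
      have h := norm_mollifierPairSum_le hB hM1 hC (by norm_num : (0 : ℝ) ≤ 1) (by positivity) n.1 n.2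
        (fun a b ↦ KowalskiMichel2000.pet q a b) hG
      simpa only using h
    have hwt := weight_offBox_le (q := q) h0.1 h0.2 hout
    -- assemble
    have hnormF : ‖F n‖ = 2 * KMV2000.qhat q *
        ((((n.1 : ℝ) * n.2) ^ (-(1 / 2 : ℝ))) * KMV2000.cutoffW ((n.1 : ℝ) * n.2 / KMV2000.qhat q ^ 2)) *
        ‖∑ m₁ ∈ Icc 1 ⌊M⌋₊, ∑ m₂ ∈ Icc 1 ⌊M⌋₊,
          (KMV2000.mollifierCoeff P M m₁ : ℂ) * (KMV2000.mollifierCoeff P M m₂ : ℂ) *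
          ∑ d₁ ∈ (Nat.gcd m₁ n.1).divisors, ∑ d₂ ∈ (Nat.gcd m₂ n.2).divisors,
            KowalskiMichel2000.pet q (m₁ * n.1 / d₁ ^ 2) (m₂ * n.2 / d₂ ^ 2)‖ := by
      rw [hFdef]
      simp only
      rw [norm_mul, norm_mul, norm_mul, norm_weight_eq, Complex.norm_ofNat, Complex.norm_real, Real.norm_eq_abs,
        abs_of_pos hqh0]
      ring
    rw [hnormF, hgdef]
    simp only
    calc 2 * KMV2000.qhat q *
          ((((n.1 : ℝ) * n.2) ^ (-(1 / 2 : ℝ))) * KMV2000.cutoffW ((n.1 : ℝ) * n.2 / KMV2000.qhat q ^ 2)) * _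
        ≤ 2 * KMV2000.qhat q *
          ((((n.1 : ℝ) * n.2) ^ (-(1 / 2 : ℝ))) * KMV2000.cutoffW ((n.1 : ℝ) * n.2 / KMV2000.qhat q ^ 2)) *
          ((1 + K) * B ^ 2 * C ^ 2 * (((n.1 : ℝ) * n.2) ^ (1 : ℝ)) * S ^ 2) :=
          mul_le_mul_of_nonneg_left hinner (mul_nonneg (by positivity)
            (mul_nonneg (Real.rpow_nonneg (by positivity) _) (KMV2000.cutoffW_nonneg _)))
      _ = 2 * KMV2000.qhat q * ((1 + K) * B ^ 2 * C ^ 2 * S ^ 2) *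
          ((((n.1 : ℝ) * n.2) ^ (-(1 / 2 : ℝ))) * KMV2000.cutoffW ((n.1 : ℝ) * n.2 / KMV2000.qhat q ^ 2) *
            (((n.1 : ℝ) * n.2) ^ (1 : ℝ))) := by ring
      _ ≤ 2 * KMV2000.qhat q * ((1 + K) * B ^ 2 * C ^ 2 * S ^ 2) *
          (92160 * (12 ! : ℝ) * KMV2000.qhat q ^ (6 : ℝ) * ((q : ℝ)) ^ (-(6 : ℝ)) *
            (((n.1 : ℝ)) ^ (-(5 / 2 : ℝ)) * ((n.2 : ℝ)) ^ (-(5 / 2 : ℝ)))) := by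
          gcongr
      _ = D * (((n.1 : ℝ)) ^ (-(5 / 2 : ℝ)) * ((n.2 : ℝ)) ^ (-(5 / 2 : ℝ))) := by rw [hDdef]; ring
  -- summability on the complement and the comparison of the two series
  have hsub : Summable (fun x : {n : ℕ × ℕ // n ∉ afeBox q ×ˢ afeBox q} ↦ ‖F x‖) :=
    Summable.of_nonneg_of_le (fun _ ↦ norm_nonneg _) (fun x ↦ hpt x.1 x.2) (hgs.subtype _)
  have hcomp : ∑' x : {n : ℕ × ℕ // n ∉ afeBox q ×ˢ afeBox q}, g x ≤ ∑' n, g n := by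
    have h : ∑ x ∈ afeBox q ×ˢ afeBox q, g x + ∑' x : {n : ℕ × ℕ // n ∉ afeBox q ×ˢ afeBox q}, g x =
        ∑' n, g n := hgs.sum_add_tsum_compl
    have hnn : 0 ≤ ∑ n ∈ afeBox q ×ˢ afeBox q, g n := Finset.sum_nonneg fun n _ ↦ hg0 n
    linarith
  have htot : ∑' n, g n = D * Z₄ := by rw [hgdef, hZ₄]; exact tsum_mul_left
  show ‖∑' x : {n : ℕ × ℕ // n ∉ afeBox q ×ˢ afeBox q}, F x‖ ≤ _
  calc ‖∑' x : {n : ℕ × ℕ // n ∉ afeBox q ×ˢ afeBox q}, F x‖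
      ≤ ∑' x : {n : ℕ × ℕ // n ∉ afeBox q ×ˢ afeBox q}, ‖F x‖ := norm_tsum_le_tsum_norm hsub
    _ ≤ ∑' x : {n : ℕ × ℕ // n ∉ afeBox q ×ˢ afeBox q}, g x :=
        Summable.tsum_le_tsum (fun x ↦ hpt x.1 x.2) hsub (hgs.subtype _)
    _ ≤ ∑' n, g n := hcomp
    _ = D * Z₄ := htot
    _ ≤ (2 * ((1 + K) * B ^ 2 * C ^ 2) * (92160 * (12 ! : ℝ))) * Z₄ := by gcongr

/-! ## §3. The identification at `Q = 1` -/

/-- Linearity of the explicit box sum in its pair kernel (the `Q = 1`, `cutoffW` form). -/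
theorem boxSum_kernel_sub (q : ℕ) [NeZero q] (P : ℝ[X]) (M : ℝ) (κ₁ κ₂ : ℕ → ℕ → ℂ) :
    ∑ n₁ ∈ afeBox q, ∑ n₂ ∈ afeBox q,
        ((((n₁ : ℝ) * n₂) ^ (-(1 / 2 : ℝ)) : ℝ) : ℂ) *
          ((KMV2000.cutoffW ((n₁ : ℝ) * n₂ / KMV2000.qhat q ^ 2) : ℝ) : ℂ) *
        ∑ m₁ ∈ Icc 1 ⌊M⌋₊, ∑ m₂ ∈ Icc 1 ⌊M⌋₊,
          (KMV2000.mollifierCoeff P M m₁ : ℂ) * (KMV2000.mollifierCoeff P M m₂ : ℂ) *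
          ∑ d₁ ∈ (Nat.gcd m₁ n₁).divisors, ∑ d₂ ∈ (Nat.gcd m₂ n₂).divisors,
            (κ₁ (m₁ * n₁ / d₁ ^ 2) (m₂ * n₂ / d₂ ^ 2) - κ₂ (m₁ * n₁ / d₁ ^ 2) (m₂ * n₂ / d₂ ^ 2)) =
      (∑ n₁ ∈ afeBox q, ∑ n₂ ∈ afeBox q,
        ((((n₁ : ℝ) * n₂) ^ (-(1 / 2 : ℝ)) : ℝ) : ℂ) *
          ((KMV2000.cutoffW ((n₁ : ℝ) * n₂ / KMV2000.qhat q ^ 2) : ℝ) : ℂ) *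
        ∑ m₁ ∈ Icc 1 ⌊M⌋₊, ∑ m₂ ∈ Icc 1 ⌊M⌋₊,
          (KMV2000.mollifierCoeff P M m₁ : ℂ) * (KMV2000.mollifierCoeff P M m₂ : ℂ) *
          ∑ d₁ ∈ (Nat.gcd m₁ n₁).divisors, ∑ d₂ ∈ (Nat.gcd m₂ n₂).divisors,
            κ₁ (m₁ * n₁ / d₁ ^ 2) (m₂ * n₂ / d₂ ^ 2)) -
      (∑ n₁ ∈ afeBox q, ∑ n₂ ∈ afeBox q,
        ((((n₁ : ℝ) * n₂) ^ (-(1 / 2 : ℝ)) : ℝ) : ℂ) *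
          ((KMV2000.cutoffW ((n₁ : ℝ) * n₂ / KMV2000.qhat q ^ 2) : ℝ) : ℂ) *
        ∑ m₁ ∈ Icc 1 ⌊M⌋₊, ∑ m₂ ∈ Icc 1 ⌊M⌋₊,
          (KMV2000.mollifierCoeff P M m₁ : ℂ) * (KMV2000.mollifierCoeff P M m₂ : ℂ) *
          ∑ d₁ ∈ (Nat.gcd m₁ n₁).divisors, ∑ d₂ ∈ (Nat.gcd m₂ n₂).divisors,
            κ₂ (m₁ * n₁ / d₁ ^ 2) (m₂ * n₂ / d₂ ^ 2)) := by
  simp only [Finset.sum_sub_distrib, mul_sub]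

/-- **§3. THE IDENTIFICATION AT `Q = 1` (the `Q = 1` slice of `stub_identP`, PROVED):** for every real polynomial `P` and every
cut `ρ` with `ρ(Δ') ≤ 8` on `(1, 3/2]` there is `C` such that for all `Δ' ∈ (1, 3/2]` and all primes `q ≥ 64`,
`‖tail q ρ P 1 Δ' − (−farLayers q ρ P 1 Δ')‖ ≤ C · q̂ · (log q̂)⁻³` — indeed `≤ C/27`, the difference-defined tail of deck 21a IS
minus the far layers up to the two truncation errors (AFE box `nᵢ ≤ q²`, layers `r ≤ q⁸`), both `O(1)`. -/
theorem tailNearFar_atOne (P : ℝ[X]) (ρ : ℝ → ℝ) (hρ : ∀ Δ' : ℝ, 1 < Δ' → Δ' ≤ 3 / 2 → ρ Δ' ≤ 8) :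
    ∃ C : ℝ, ∀ Δ' : ℝ, 1 < Δ' → Δ' ≤ 3 / 2 → ∀ (q : ℕ) [NeZero q], q.Prime → 64 ≤ q →
      ‖tail q ρ P 1 Δ' - -farLayers q ρ P 1 Δ'‖ ≤
        C * KMV2000.qhat q * (Real.log (KMV2000.qhat q))⁻¹ ^ 3 := by
  obtain ⟨A, hA0, hA⟩ := norm_boxSum_le P
  obtain ⟨A', hA'0, hA'⟩ := norm_offBoxTsum_le P
  refine ⟨27 * (2 * A + A'), fun Δ' h1 h32 q _ hq h64 ↦ ?_⟩
  have h0 : 0 < Δ' := by linarith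
  obtain ⟨hM1, hM32, hMq⟩ := mollifierLength_facts h64 h0 h32
  have hqh1 : 1 < KMV2000.qhat q := one_lt_qhat h64
  have hqh0 : 0 < KMV2000.qhat q := zero_lt_one.trans hqh1
  -- the difference-defined tail plus the far layers, as `Q^h − (D − Σ_{r ≤ q⁸} K_r)`
  have hE := tail_add_farLayers q ρ P 1 Δ' (layerCount_le_pow_eight h64 (hρ Δ' h1 h32))
  -- the exact dictionary and its box / off-box split
  have hQ := QhPQ_one_eq_tsum_pet hq P hMq
  have hsplit :
      (∑ n₁ ∈ afeBox q, ∑ n₂ ∈ afeBox q, 2 * (KMV2000.qhat q : ℂ) *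
        (((((n₁ : ℝ) * n₂) ^ (-(1 / 2 : ℝ)) : ℝ) : ℂ) *
          ((KMV2000.cutoffW ((n₁ : ℝ) * n₂ / KMV2000.qhat q ^ 2) : ℝ) : ℂ) *
        ∑ m₁ ∈ Icc 1 ⌊KMV2000.qhat q ^ Δ'⌋₊, ∑ m₂ ∈ Icc 1 ⌊KMV2000.qhat q ^ Δ'⌋₊,
          (KMV2000.mollifierCoeff P (KMV2000.qhat q ^ Δ') m₁ : ℂ) *
            (KMV2000.mollifierCoeff P (KMV2000.qhat q ^ Δ') m₂ : ℂ) *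
          ∑ d₁ ∈ (Nat.gcd m₁ n₁).divisors, ∑ d₂ ∈ (Nat.gcd m₂ n₂).divisors,
            KowalskiMichel2000.pet q (m₁ * n₁ / d₁ ^ 2) (m₂ * n₂ / d₂ ^ 2))) +
      (∑' x : {n : ℕ × ℕ // n ∉ afeBox q ×ˢ afeBox q},
          (2 * (KMV2000.qhat q : ℂ) *
            (((((x.1.1 : ℝ) * x.1.2) ^ (-(1 / 2 : ℝ)) : ℝ) : ℂ) *
              ((KMV2000.cutoffW ((x.1.1 : ℝ) * x.1.2 / KMV2000.qhat q ^ 2) : ℝ) : ℂ) *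
            ∑ m₁ ∈ Icc 1 ⌊KMV2000.qhat q ^ Δ'⌋₊, ∑ m₂ ∈ Icc 1 ⌊KMV2000.qhat q ^ Δ'⌋₊,
              (KMV2000.mollifierCoeff P (KMV2000.qhat q ^ Δ') m₁ : ℂ) *
                (KMV2000.mollifierCoeff P (KMV2000.qhat q ^ Δ') m₂ : ℂ) *
              ∑ d₁ ∈ (Nat.gcd m₁ x.1.1).divisors, ∑ d₂ ∈ (Nat.gcd m₂ x.1.2).divisors,
                KowalskiMichel2000.pet q (m₁ * x.1.1 / d₁ ^ 2) (m₂ * x.1.2 / d₂ ^ 2)))) =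
      ∑' n : ℕ × ℕ, 2 * (KMV2000.qhat q : ℂ) *
        (((((n.1 : ℝ) * n.2) ^ (-(1 / 2 : ℝ)) : ℝ) : ℂ) *
          ((KMV2000.cutoffW ((n.1 : ℝ) * n.2 / KMV2000.qhat q ^ 2) : ℝ) : ℂ) *
        ∑ m₁ ∈ Icc 1 ⌊KMV2000.qhat q ^ Δ'⌋₊, ∑ m₂ ∈ Icc 1 ⌊KMV2000.qhat q ^ Δ'⌋₊,
          (KMV2000.mollifierCoeff P (KMV2000.qhat q ^ Δ') m₁ : ℂ) *
            (KMV2000.mollifierCoeff P (KMV2000.qhat q ^ Δ') m₂ : ℂ) *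
          ∑ d₁ ∈ (Nat.gcd m₁ n.1).divisors, ∑ d₂ ∈ (Nat.gcd m₂ n.2).divisors,
            KowalskiMichel2000.pet q (m₁ * n.1 / d₁ ^ 2) (m₂ * n.2 / d₂ ^ 2)) := by
    have h0 := (summable_dictionaryTermAtOne hq P hMq).sum_add_tsum_compl (s := afeBox q ×ˢ afeBox q)
    rw [Finset.sum_product] at h0
    exact h0
  have hD := diagPart_sub_sum_layer_one q P Δ' (q ^ 8)
  have hlin := boxSum_kernel_sub q P (KMV2000.qhat q ^ Δ') (KowalskiMichel2000.pet q)
    (fun a b ↦ diagKernel a b - ∑ r ∈ Icc 1 (q ^ 8), layerKernel q r a b)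
  have hbox := hA q hq h64 Δ' h0 h32
  have hoff := hA' q hq h64 Δ' h0 h32
  -- `Σ_{n₁,n₂} 2q̂·(w·I) = 2q̂ · Σ_{n₁,n₂} w·I`
  have hfac : (∑ n₁ ∈ afeBox q, ∑ n₂ ∈ afeBox q, 2 * (KMV2000.qhat q : ℂ) *
        (((((n₁ : ℝ) * n₂) ^ (-(1 / 2 : ℝ)) : ℝ) : ℂ) *
          ((KMV2000.cutoffW ((n₁ : ℝ) * n₂ / KMV2000.qhat q ^ 2) : ℝ) : ℂ) *
        ∑ m₁ ∈ Icc 1 ⌊KMV2000.qhat q ^ Δ'⌋₊, ∑ m₂ ∈ Icc 1 ⌊KMV2000.qhat q ^ Δ'⌋₊,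
          (KMV2000.mollifierCoeff P (KMV2000.qhat q ^ Δ') m₁ : ℂ) *
            (KMV2000.mollifierCoeff P (KMV2000.qhat q ^ Δ') m₂ : ℂ) *
          ∑ d₁ ∈ (Nat.gcd m₁ n₁).divisors, ∑ d₂ ∈ (Nat.gcd m₂ n₂).divisors,
            KowalskiMichel2000.pet q (m₁ * n₁ / d₁ ^ 2) (m₂ * n₂ / d₂ ^ 2))) =
      2 * (KMV2000.qhat q : ℂ) * ∑ n₁ ∈ afeBox q, ∑ n₂ ∈ afeBox q,
        ((((n₁ : ℝ) * n₂) ^ (-(1 / 2 : ℝ)) : ℝ) : ℂ) *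
          ((KMV2000.cutoffW ((n₁ : ℝ) * n₂ / KMV2000.qhat q ^ 2) : ℝ) : ℂ) *
        ∑ m₁ ∈ Icc 1 ⌊KMV2000.qhat q ^ Δ'⌋₊, ∑ m₂ ∈ Icc 1 ⌊KMV2000.qhat q ^ Δ'⌋₊,
          (KMV2000.mollifierCoeff P (KMV2000.qhat q ^ Δ') m₁ : ℂ) *
            (KMV2000.mollifierCoeff P (KMV2000.qhat q ^ Δ') m₂ : ℂ) *
          ∑ d₁ ∈ (Nat.gcd m₁ n₁).divisors, ∑ d₂ ∈ (Nat.gcd m₂ n₂).divisors,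
            KowalskiMichel2000.pet q (m₁ * n₁ / d₁ ^ 2) (m₂ * n₂ / d₂ ^ 2) := by
    rw [Finset.mul_sum]
    refine Finset.sum_congr rfl fun n₁ _ ↦ ?_
    rw [Finset.mul_sum]
  -- norms
  have hlog : 0 < Real.log (KMV2000.qhat q) := Real.log_pos hqh1
  have hkey : 1 ≤ 27 * (KMV2000.qhat q * (Real.log (KMV2000.qhat q))⁻¹ ^ 3) := by
    have hl := Real.log_le_rpow_div hqh0.le (by norm_num : (0 : ℝ) < 1 / 3)
    have hl3 : Real.log (KMV2000.qhat q) ^ 3 ≤ 27 * KMV2000.qhat q := by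
      have hnn : 0 ≤ KMV2000.qhat q ^ (1 / 3 : ℝ) := Real.rpow_nonneg hqh0.le _
      have h3 : Real.log (KMV2000.qhat q) ≤ 3 * KMV2000.qhat q ^ (1 / 3 : ℝ) := by linarith
      calc Real.log (KMV2000.qhat q) ^ 3 ≤ (3 * KMV2000.qhat q ^ (1 / 3 : ℝ)) ^ 3 :=
            pow_le_pow_left₀ hlog.le h3 3
        _ = 27 * (KMV2000.qhat q ^ (1 / 3 : ℝ)) ^ (3 : ℕ) := by ring
        _ = 27 * KMV2000.qhat q := by
            rw [← Real.rpow_natCast, ← Real.rpow_mul hqh0.le]; norm_num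
    rw [inv_pow, ← div_eq_mul_inv, ← mul_div_assoc, one_le_div (pow_pos hlog 3)]
    linarith
  -- the main estimate `‖E‖ ≤ 2A + A'`
  have hmain : ‖tail q ρ P 1 Δ' + farLayers q ρ P 1 Δ'‖ ≤ 2 * A + A' := by
    rw [hE, hQ, ← hsplit, hfac]
    -- `(2q̂·B_pet + off) − D + ΣL = 2q̂·(B_pet − B_κ) + off`
    have e : ∀ (Bp Bk off D L c : ℂ), D - L = c * Bk →
        c * Bp + off - D + L = c * (Bp - Bk) + off := by
      intro Bp Bk off D L c h
      have : D = c * Bk + L := by rw [← h]; ring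
      rw [this]; ring
    rw [e _ _ _ _ _ _ hD, ← hlin]
    calc _ ≤ ‖2 * (KMV2000.qhat q : ℂ) * _‖ + ‖_‖ := norm_add_le _ _
      _ ≤ 2 * A + A' := by
          refine add_le_add ?_ hoff
          rw [norm_mul, norm_mul, Complex.norm_ofNat, Complex.norm_real, Real.norm_eq_abs, abs_of_pos hqh0]
          calc 2 * KMV2000.qhat q * _ ≤ 2 * KMV2000.qhat q * (A * (KMV2000.qhat q)⁻¹) :=
                mul_le_mul_of_nonneg_left hbox (by positivity)
            _ = 2 * A := by field_simp
  rw [sub_neg_eq_add]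
  calc ‖tail q ρ P 1 Δ' + farLayers q ρ P 1 Δ'‖ ≤ 2 * A + A' := hmain
    _ ≤ (2 * A + A') * (27 * (KMV2000.qhat q * (Real.log (KMV2000.qhat q))⁻¹ ^ 3)) :=
        le_mul_of_one_le_right (by positivity) hkey
    _ = 27 * (2 * A + A') * KMV2000.qhat q * (Real.log (KMV2000.qhat q))⁻¹ ^ 3 := by ring

end Summit.Parity.GeneralizedHardyLittlewood.Theorems.PrimeLevelFamEdgeIdeaDeltas.PeterssonLayers

end
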